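import Literature.Analysis.ValidatedNumerics.FixedPointInterval
import HarnessLib

/-!
# Two-sided, Newton-seeded square roots for the kernel fixed-point interval kit

Topic `Literature/Analysis/ValidatedNumerics` (companion of `FixedPointInterval.lean`, whose
`FI.sqrtI I = [0, sqrtUp I]` is ONE-sided and found by a 140-step bisection). For certified
quadratures that take many square roots of positive quantities (e.g. `a = √(a²)` in closed-form
densities of states) the lower end matters and the kernel cost per root matters. Following the
standard "compute, then check" pattern of validated numerics (Moore–Kearfott–Cloud §7; Brent–
Zimmermann §1.5.1 `SqrtInt`): an integer Newton iteration from a fixed seed produces a CANDIDATE,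
and the returned values are CORRECTED/VALIDATED by squaring, so that soundness is a two-line case
analysis independent of convergence (insufficient fuel can only loosen the enclosure, never break it):

* `natSqrtNewton m fuel x` — integer Newton steps `x ↦ (x + m / x) / 2` while they decrease;
* `natSqrtFloor m` / `natSqrtCeil m` — validated lower / upper integer square roots:
  `(natSqrtFloor m)² ≤ m ≤ (natSqrtCeil m)²` (`natSqrtFloor_sq_le`, `le_natSqrtCeil_sq`), for ALL `m`;
* `FI.sqrt I = [natSqrtFloor (lo⁺·2^48), natSqrtCeil (hi⁺·2^48)]` with `FI.mem_sqrt`: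
  `x ∈ I ⟹ √x ∈ FI.sqrt I` (two-sided; `√x = 0` enclosed for `x ≤ 0`).

Seed `2^50` and at most `64` decreasing Newton steps are exact (`natSqrtFloor m = ⌊√m⌋`) for `m < 2^100`, i.e. for
intervals inside `[0, 16)` at scale `2^48` — the range of the band-structure quantities these roots
serve; outside it the results remain sound.

## References
* [MooreKearfottCloud2009] R. E. Moore, R. B. Kearfott, M. J. Cloud, *Introduction to Interval
  Analysis*, SIAM (2009), §7 (interval enclosures of elementary functions; a posteriori validation).
* [BrentZimmermann2010] R. P. Brent, P. Zimmermann, *Modern Computer Arithmetic*, CUP (2010),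
  §1.5.1 (integer square root by Newton's iteration, final correction).
-/

namespace Literature.Analysis.ValidatedNumerics.Numerics

/-! ### Integer Newton iteration with validation -/

/-- Integer Newton steps for `√m`: `x ↦ (x + m / x) / 2`, stopping as soon as the iterate no
longer decreases (or the fuel is exhausted); returns the last iterate. [cite: BrentZimmermann2010, §1.5.1] -/
def natSqrtNewton (m : ℕ) : ℕ → ℕ → ℕ
  | 0, x => x
  | fuel + 1, x =>
      let y := (x + m / x) / 2
      cond (Nat.blt y x) (natSqrtNewton m fuel y) x

/-- The Newton candidate for `⌊√m⌋` from the fixed seed `2^50` with at most `64` decreasing steps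
(exact for `m < 2^100`, `≈ 6` steps for `m ≈ 2^97`; any value is acceptable for soundness, see
`natSqrtFloor`). [cite: BrentZimmermann2010, §1.5.1] -/
def natSqrtCand (m : ℕ) : ℕ := natSqrtNewton m 64 1125899906842624

/-- **Validated lower integer square root**: the candidate `r`, corrected to `r - 1` if `r² > m`,
and to `0` if that still fails; always `(natSqrtFloor m)² ≤ m`. [cite: MooreKearfottCloud2009, §7] -/
def natSqrtFloor (m : ℕ) : ℕ :=
  let r := natSqrtCand m
  cond (Nat.ble (r * r) m) r (cond (Nat.ble ((r - 1) * (r - 1)) m) (r - 1) 0)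

/-- **Validated upper integer square root**: the candidate `r`, corrected to `r + 1` if `r² < m`,
and to `max m 1` if that still fails; always `m ≤ (natSqrtCeil m)²`. [cite: MooreKearfottCloud2009, §7] -/
def natSqrtCeil (m : ℕ) : ℕ :=
  let r := natSqrtCand m
  cond (Nat.ble m (r * r)) r (cond (Nat.ble m ((r + 1) * (r + 1))) (r + 1) (max m 1))

/-- `(natSqrtFloor m)² ≤ m` for every `m` (by construction: the returned value passed the test,
or is `0`). [cite: MooreKearfottCloud2009, §7] -/
theorem natSqrtFloor_sq_le (m : ℕ) : natSqrtFloor m ^ 2 ≤ m := by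
  unfold natSqrtFloor
  simp only
  cases h1 : Nat.ble (natSqrtCand m * natSqrtCand m) m
  · cases h2 : Nat.ble ((natSqrtCand m - 1) * (natSqrtCand m - 1)) m
    · simp
    · simpa [sq] using Nat.le_of_ble_eq_true h2
  · simpa [sq] using Nat.le_of_ble_eq_true h1

/-- `m ≤ (natSqrtCeil m)²` for every `m`. [cite: MooreKearfottCloud2009, §7] -/
theorem le_natSqrtCeil_sq (m : ℕ) : m ≤ natSqrtCeil m ^ 2 := by
  unfold natSqrtCeil
  simp only
  cases h1 : Nat.ble m (natSqrtCand m * natSqrtCand m)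
  · cases h2 : Nat.ble m ((natSqrtCand m + 1) * (natSqrtCand m + 1))
    · simp only [cond_false]
      rcases Nat.eq_zero_or_pos m with rfl | hm
      · simp
      · calc m = m * 1 := (mul_one m).symm
          _ ≤ max m 1 * max m 1 := Nat.mul_le_mul (le_max_left _ _) (le_max_right _ _)
          _ = max m 1 ^ 2 := (sq _).symm
    · simpa [sq] using Nat.le_of_ble_eq_true h2
  · simpa [sq] using Nat.le_of_ble_eq_true h1

/-- Sanity check of exactness at a 97-bit argument (kernel decision): the floor and the ceiling
coincide with `⌊√m⌋` and `⌈√m⌉`. [cite: BrentZimmermann2010, §1.5.1] -/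
example : natSqrtFloor (3 * 2 ^ 95 + 12345) = 344735034151442 ∧
    natSqrtCeil (3 * 2 ^ 95 + 12345) = 344735034151443 := by decide +kernel

namespace FI

/-! ### Two-sided square root of an interval -/

/-- **Two-sided square root**: for `I = [lo, hi]/2^48`,
`FI.sqrt I = [natSqrtFloor (lo⁺ · 2^48), natSqrtCeil (hi⁺ · 2^48)]` encloses `√x · 2^48` for
`x ∈ I` (`lo⁺ = max lo 0`; `√x = 0` for `x ≤ 0`). [cite: MooreKearfottCloud2009, §7] -/
def sqrt (I : FI) : FI :=
  ⟨(natSqrtFloor (I.lo.toNat * SC) : ℤ), (natSqrtCeil (I.hi.toNat * SC) : ℤ)⟩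

/-- **Soundness of `FI.sqrt`**: `x ∈ I ⟹ √x ∈ FI.sqrt I`. [cite: MooreKearfottCloud2009, §7] -/
theorem mem_sqrt {x : ℝ} {I : FI} (hx : mem x I) : mem (Real.sqrt x) (sqrt I) := by
  simp only [mem, sqrt, Int.cast_natCast]
  constructor
  · -- lower end: `r² ≤ lo⁺·S ≤ x S²` gives `r ≤ √x · S`
    set m : ℕ := I.lo.toNat * SC with hm
    have h1 : ((natSqrtFloor m : ℕ) : ℝ) ^ 2 ≤ (m : ℝ) := by exact_mod_cast natSqrtFloor_sq_le m
    have hr : (0 : ℝ) ≤ natSqrtFloor m := by positivity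
    rcases le_or_gt I.lo 0 with hlo | hlo
    · -- `lo ≤ 0`: then `m = 0`, so the lower end is `0`
      have hm0 : (m : ℝ) = 0 := by rw [hm, Int.toNat_of_nonpos hlo, zero_mul]; simp
      have hr0 : ((natSqrtFloor m : ℕ) : ℝ) = 0 := by
        rw [hm0] at h1
        exact le_antisymm (by nlinarith [hr, h1]) hr
      rw [hr0]; positivity
    · have hx0 : 0 < x := by
        have : (0 : ℝ) < I.lo := by exact_mod_cast hlo
        nlinarith [hx.1, SC_pos]
      have htoNat : ((I.lo.toNat : ℕ) : ℝ) = (I.lo : ℝ) := by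
        rw [← Int.cast_natCast, Int.toNat_of_nonneg hlo.le]
      have h2 : (m : ℝ) ≤ x * (SC : ℝ) ^ 2 := by
        rw [hm]; push_cast; rw [htoNat]; nlinarith [hx.1, SC_pos]
      rw [← Real.sqrt_sq hr, ← Real.sqrt_sq SC_pos.le, ← Real.sqrt_mul hx0.le]
      exact Real.sqrt_le_sqrt (h1.trans h2)
  · -- upper end: as `FI.mem_sqrtI`
    set m : ℕ := I.hi.toNat * SC with hm
    have h1 : (m : ℝ) ≤ ((natSqrtCeil m : ℕ) : ℝ) ^ 2 := by exact_mod_cast le_natSqrtCeil_sq m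
    have htoNat : (I.hi : ℝ) ≤ ((I.hi.toNat : ℕ) : ℝ) := by
      rw [← Int.cast_natCast]; exact_mod_cast Int.self_le_toNat I.hi
    have h2 : x * (SC : ℝ) ^ 2 ≤ (m : ℝ) := by
      rw [hm]; push_cast
      have : x * SC ≤ ((I.hi.toNat : ℕ) : ℝ) := hx.2.trans htoNat
      nlinarith [SC_pos]
    have hr : (0 : ℝ) ≤ natSqrtCeil m := by positivity
    rcases le_or_gt x 0 with hx0 | hx0
    · rw [Real.sqrt_eq_zero'.2 hx0]; simp
    · rw [← Real.sqrt_sq hr, ← Real.sqrt_sq SC_pos.le, ← Real.sqrt_mul hx0.le]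
      exact Real.sqrt_le_sqrt (h2.trans h1)

/-- Worked enclosure: `√2 ∈ FI.sqrt [2, 2]`, an interval of width `2^{-48}` around `1.41421356…`
(kernel decision on the endpoints). [cite: BrentZimmermann2010, §1.5.1] -/
theorem sqrt_two_encl : sqrt (ofInt 2) = ⟨398065729532860, 398065729532861⟩ := by decide +kernel

/-- `√2 · 2^48 ∈ [398065729532860, 398065729532861]`. [cite: BrentZimmermann2010, §1.5.1] -/
theorem mem_sqrt_two : mem (Real.sqrt 2) ⟨398065729532860, 398065729532861⟩ := by
  rw [← sqrt_two_encl]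
  exact mem_sqrt (by exact_mod_cast mem_ofInt 2)

end FI

end Literature.Analysis.ValidatedNumerics.Numerics
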